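import Mathlib.Analysis.InnerProductSpace.Dual
import Mathlib.Analysis.Normed.Module.HahnBanach
import HarnessLib

/-!
# Lions' projection theorem (the Lax–Milgram lemma of J.-L. Lions for a non-closed subspace)

J.-L. Lions, *Équations différentielles opérationnelles et problèmes aux limites*, Springer 1961,
Chap. III, Thm. 1.1 (also Lions–Magenes, *Non-homogeneous boundary value problems* I, Chap. 3,
Thm. 1.1 "Lions' theorem"; R. E. Showalter, *Monotone operators in Banach space and nonlinear
partial differential equations*, AMS 1997, Thm. III.2.1): **let `F` be a real Hilbert space and
`Φ` a linear space mapped linearly into `F` by `j`, carrying a "norm" `q ≥ 0` with `‖j φ‖ ≤ C q(φ)`;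
let `E : F × Φ → ℝ` be bilinear, continuous on `F` in the first variable for each fixed `φ`, and
coercive on `Φ`: `E(jφ, φ) ≥ α q(φ)²`, `α > 0`. Then for every linear functional `L` on `Φ` with
`|L φ| ≤ C_L q(φ)` there is `u ∈ F` with `E(u, φ) = L(φ)` for all `φ ∈ Φ`.** (Nothing is asked
of the topology of `Φ`; `q` need not be a norm.) This is the abstract existence theorem behind weak
solutions of linear parabolic equations (Lions 1961, Chap. IV; Lions–Magenes I, Chap. 3, §4), with
`F = L²` of space-time, `Φ` the smooth test functions vanishing at the final time, `E(u, φ) = ∫ u ᵗPφ`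
and `q(φ)² = ‖φ‖²_{L²H¹} + ½‖φ(0)‖²`.

Proof (Lions): by the Riesz representation `E(u, φ) = ⟪Kφ, u⟫` with `K : Φ → F` linear;
coercivity gives `q(φ) ≤ (C/α) ‖Kφ‖`, so `Kφ ↦ L(φ)` is a well defined bounded functional on the
range of `K`; extend it to `F` (Hahn–Banach) and represent it by `u` (Riesz).

* `exists_eq_of_coercive` — the theorem.

Everything is proved; no definitions, no named facts.

## References

* J.-L. Lions, *Équations différentielles opérationnelles et problèmes aux limites*, Grundlehren
  111, Springer 1961, Chap. III, Thm. 1.1. [folklore]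
* J.-L. Lions, E. Magenes, *Non-homogeneous boundary value problems and applications* I,
  Springer 1972, Chap. 3, Thm. 1.1 and Remark 1.3. [folklore]
-/

noncomputable section

open scoped RealInnerProductSpace

namespace Literature.Analysis.OperatorTheory

variable {F : Type*} [NormedAddCommGroup F] [InnerProductSpace ℝ F] [CompleteSpace F]
  {Φ : Type*} [AddCommGroup Φ] [Module ℝ Φ]

/-- **Lions' projection theorem** (Lions 1961, Chap. III, Thm. 1.1). Let `F` be a real Hilbert
space, `Φ` a real vector space with a linear map `j : Φ → F` and a function `q : Φ → ℝ≥0` such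
that `‖j φ‖ ≤ C q(φ)` (`C ≥ 0`). Let `E : F → Φ → ℝ` be bilinear with `|E(u, φ)| ≤ K(φ) ‖u‖`
(continuity in `u` for each `φ`) and `α q(φ)² ≤ E(j φ, φ)` (`α > 0`). Then every linear
`L : Φ → ℝ` with `|L φ| ≤ C_L q(φ)` (`C_L ≥ 0`) is of the form `L(φ) = E(u, φ)` for some `u ∈ F`.
[folklore] -/
theorem exists_eq_of_coercive (j : Φ →ₗ[ℝ] F) (q : Φ → ℝ) (hq : ∀ φ, 0 ≤ q φ) {C : ℝ}
    (hC : 0 ≤ C) (hj : ∀ φ, ‖j φ‖ ≤ C * q φ) (E : F →ₗ[ℝ] Φ →ₗ[ℝ] ℝ)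
    (hE : ∀ φ, ∃ K : ℝ, ∀ u, |E u φ| ≤ K * ‖u‖) {α : ℝ} (hα : 0 < α)
    (hcoer : ∀ φ, α * q φ ^ 2 ≤ E (j φ) φ) (L : Φ →ₗ[ℝ] ℝ) {CL : ℝ} (hCL : 0 ≤ CL)
    (hL : ∀ φ, |L φ| ≤ CL * q φ) :
    ∃ u : F, ∀ φ, E u φ = L φ := by
  classical
  -- Riesz representation of `u ↦ E u φ`: `E u φ = ⟪K φ, u⟫`
  have hEclm : ∀ φ, ∃ f : F →L[ℝ] ℝ, ∀ u, f u = E u φ := by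
    intro φ
    obtain ⟨K, hK⟩ := hE φ
    refine ⟨LinearMap.mkContinuous (E.flip φ) (max K 0) fun u ↦ ?_, fun u ↦ rfl⟩
    rw [Real.norm_eq_abs]
    exact (hK u).trans (mul_le_mul_of_nonneg_right (le_max_left _ _) (norm_nonneg _))
  choose f hf using hEclm
  set K : Φ → F := fun φ ↦ (InnerProductSpace.toDual ℝ F).symm (f φ) with hKdef
  have hKE : ∀ φ u, E u φ = ⟪K φ, u⟫ := by
    intro φ u
    rw [hKdef, InnerProductSpace.toDual_symm_apply, hf]
  -- `K` is linear (uniqueness of the representation)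
  have hK_add : ∀ φ ψ, K (φ + ψ) = K φ + K ψ := by
    intro φ ψ
    refine ext_inner_right ℝ fun u ↦ ?_
    rw [inner_add_left, ← hKE, ← hKE, ← hKE, map_add]
  have hK_smul : ∀ (c : ℝ) φ, K (c • φ) = c • K φ := by
    intro c φ
    refine ext_inner_right ℝ fun u ↦ ?_
    rw [inner_smul_left, ← hKE, ← hKE, map_smul]
    simp
  set Kl : Φ →ₗ[ℝ] F := { toFun := K, map_add' := hK_add, map_smul' := hK_smul } with hKl
  have hKl_apply : ∀ φ, Kl φ = K φ := fun φ ↦ rfl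
  -- the key estimate `q φ ≤ (C/α) ‖K φ‖`
  have hqK : ∀ φ, q φ ≤ C / α * ‖K φ‖ := by
    intro φ
    have h1 : α * q φ ^ 2 ≤ ‖K φ‖ * (C * q φ) := by
      calc α * q φ ^ 2 ≤ E (j φ) φ := hcoer φ
        _ = ⟪K φ, j φ⟫ := hKE φ (j φ)
        _ ≤ ‖K φ‖ * ‖j φ‖ := real_inner_le_norm _ _
        _ ≤ ‖K φ‖ * (C * q φ) := mul_le_mul_of_nonneg_left (hj φ) (norm_nonneg _)
    rcases (hq φ).eq_or_lt with h0 | hpos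
    · rw [← h0]; positivity
    · -- divide `α q² ≤ ‖Kφ‖ C q` by `α q`
      have h2 : α * q φ ≤ ‖K φ‖ * C := by nlinarith
      rw [div_mul_eq_mul_div, le_div_iff₀ hα]
      nlinarith
  -- `L` is bounded by `‖K φ‖` (hence vanishes where `K` does)
  have hLK : ∀ φ, |L φ| ≤ CL * (C / α) * ‖K φ‖ := fun φ ↦
    calc |L φ| ≤ CL * q φ := hL φ
      _ ≤ CL * (C / α * ‖K φ‖) := mul_le_mul_of_nonneg_left (hqK φ) hCL
      _ = CL * (C / α) * ‖K φ‖ := by ring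
  -- the functional on the range of `K`
  set R : Submodule ℝ F := LinearMap.range Kl with hR
  have hwd : ∀ φ ψ, K φ = K ψ → L φ = L ψ := by
    intro φ ψ h
    have h1 : K (φ - ψ) = 0 := by
      rw [sub_eq_add_neg, hK_add, ← neg_one_smul ℝ ψ, hK_smul, h]; simp
    have h2 : |L (φ - ψ)| ≤ 0 := by simpa [h1] using hLK (φ - ψ)
    have h3 : L (φ - ψ) = 0 := abs_nonpos_iff.1 h2
    rwa [map_sub, sub_eq_zero] at h3
  have hrep : ∀ y : R, ∃ φ, K φ = y := fun y ↦ by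
    obtain ⟨φ, hφ⟩ := y.2
    exact ⟨φ, hφ⟩
  choose rep hrep' using hrep
  set ℓ₀ : R → ℝ := fun y ↦ L (rep y) with hℓ₀
  have hℓ₀K : ∀ φ, ℓ₀ ⟨K φ, φ, rfl⟩ = L φ := fun φ ↦ hwd _ _ (hrep' ⟨K φ, φ, rfl⟩)
  have hℓ₀_eq : ∀ (y : R) (φ : Φ), K φ = y → ℓ₀ y = L φ := by
    intro y φ h
    have : y = ⟨K φ, φ, rfl⟩ := Subtype.ext h.symm
    rw [this, hℓ₀K]
  have hℓ₀_add : ∀ y z : R, ℓ₀ (y + z) = ℓ₀ y + ℓ₀ z := by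
    intro y z
    obtain ⟨φ, hφ⟩ : ∃ φ, K φ = y := ⟨rep y, hrep' y⟩
    obtain ⟨ψ, hψ⟩ : ∃ ψ, K ψ = z := ⟨rep z, hrep' z⟩
    rw [hℓ₀_eq y φ hφ, hℓ₀_eq z ψ hψ, hℓ₀_eq (y + z) (φ + ψ) (by rw [hK_add, hφ, hψ]; rfl),
      map_add]
  have hℓ₀_smul : ∀ (c : ℝ) (y : R), ℓ₀ (c • y) = c * ℓ₀ y := by
    intro c y
    obtain ⟨φ, hφ⟩ : ∃ φ, K φ = y := ⟨rep y, hrep' y⟩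
    rw [hℓ₀_eq y φ hφ, hℓ₀_eq (c • y) (c • φ) (by rw [hK_smul, hφ]; rfl), map_smul, smul_eq_mul]
  set ℓ₁ : R →ₗ[ℝ] ℝ := { toFun := ℓ₀, map_add' := hℓ₀_add, map_smul' := hℓ₀_smul } with hℓ₁
  have hℓ₁_bound : ∀ y : R, ‖ℓ₁ y‖ ≤ CL * (C / α) * ‖y‖ := by
    intro y
    obtain ⟨φ, hφ⟩ : ∃ φ, K φ = y := ⟨rep y, hrep' y⟩
    have h1 : ℓ₁ y = L φ := hℓ₀_eq y φ hφ
    rw [h1, Real.norm_eq_abs]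
    have hy : ‖(y : F)‖ = ‖K φ‖ := by rw [hφ]
    calc |L φ| ≤ CL * (C / α) * ‖K φ‖ := hLK φ
      _ = CL * (C / α) * ‖y‖ := by rw [← hy]; rfl
  set ℓ : R →L[ℝ] ℝ := LinearMap.mkContinuous ℓ₁ (CL * (C / α)) hℓ₁_bound with hℓ
  -- Hahn–Banach extension and Riesz representation
  obtain ⟨g, hg, -⟩ := exists_extension_norm_eq R ℓ
  refine ⟨(InnerProductSpace.toDual ℝ F).symm g, fun φ ↦ ?_⟩
  rw [hKE, real_inner_comm, InnerProductSpace.toDual_symm_apply]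
  have h1 := hg ⟨K φ, φ, rfl⟩
  rw [h1]
  exact hℓ₀K φ

end Literature.Analysis.OperatorTheory

end
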